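import Summits.AtomisticToContinuum.BoseEinsteinCondensation.Theses.BECSwapNoCatastrophe
import Literature.MathematicalPhysics.QuantumManyBody.BosonicFloor
import Literature.MathematicalPhysics.QuantumManyBody.CouplingPathSliceFloor
import Literature.MathematicalPhysics.QuantumManyBody.GroundStateDirichletForm
import Literature.MathematicalPhysics.QuantumManyBody.DiluteBoseGasUpperBoundLocalization
import HarnessLib

/-!
# Crux `TorusHalfSwapOverlap` (stmt-AtomisticToContinuum-14393), line `birth`, stub `stub_productLower`

Route `BECSwapNoCatastrophe` (sub-problem `BoseEinsteinCondensation`). Fixed-`n` stub: on the absolute admissible class the uncoupled two-copy form is bounded below by twice the bosonic periodic ground-state energy (slicing + 'bosonic infimum = absolute infimum', `periodicGroundStateEnergy_le_lintegral_of_periodic`).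

This file proves the REGISTERED stub signature verbatim (tree vocabulary, the two-copy objects inlined as
`let`s exactly as in the route decls), under the registered name, in the line's namespace; it cannot import
the `Cruxes/` skeleton, which reads it back definitionally.
-/

noncomputable section

open MeasureTheory Filter
open scoped ENNReal NNReal BigOperators ComplexConjugate

namespace Summit.AtomisticToContinuum.BoseEinsteinCondensation.Cruxes.TorusHalfSwapOverlap.Birth

open Literature.MathematicalPhysics.QuantumManyBody.BoseGas
open Summit.AtomisticToContinuum.BoseEinsteinCondensation.Theses.BECSwapNoCatastrophe (TorusSwapPathRigidity)

/-! ### Helper lemmas (keep them `private` or inside `namespace ProductLower … end ProductLower`) -/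

namespace ProductLower

variable {M : ℕ} {L : ℝ}

/-- **Homogeneous bosonic floor.** For measurable `v` and every `C¹`, `Lℤ³`-periodic `f` on
`(ℝ³)^M` (no symmetry, no normalisation),
`E₀^per(M, L) · ∫_{[0,L)^{3M}} |f|² ≤ ∫_{[0,L)^{3M}} |∇f|² + (∑_{i<j} v^per(xᵢ - xⱼ)) |f|²`:
rescale `f` to unit mass (the mass is finite by continuity; trivial if it vanishes) and apply
'the bosonic infimum is the absolute infimum' (`periodicGroundStateEnergy_le_lintegral_of_periodic`).
[cite: LSSY2005, Ch. 2 (bosons: remark after (2.1))] -/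
theorem periodicGroundStateEnergy_mul_normSq_le_of_periodic {v : ℝ → ℝ≥0∞} (hv : Measurable v)
    {f : Config M → ℂ} (hf : ContDiff ℝ 1 f)
    (hper : ∀ (X : Config M) (i : Fin M) (k : Fin 3),
      f (X + Pi.single i (EuclideanSpace.single k L)) = f X) :
    periodicGroundStateEnergy v M L * ∫⁻ X in cellN M L, ((‖f X‖₊ : ℝ≥0∞)) ^ 2 ≤
      ∫⁻ X in cellN M L,
        (kineticDensity f X + periodicInteraction v L X * ((‖f X‖₊ : ℝ≥0∞)) ^ 2) := by
  set m := ∫⁻ X in cellN M L, ((‖f X‖₊ : ℝ≥0∞)) ^ 2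
  have hmtop : m ≠ ⊤ := lintegral_cellN_normSq_ne_top hf.continuous L
  rcases eq_or_ne m 0 with hm0 | hm0
  · rw [hm0, mul_zero]
    exact zero_le
  have hmpos : 0 < m.toReal := ENNReal.toReal_pos hm0 hmtop
  -- a normalising constant `c`, `|c|² = 1/m`
  obtain ⟨c, hc2⟩ : ∃ c : ℂ, ((‖c‖₊ : ℝ≥0∞)) ^ 2 = m⁻¹ :=
    ⟨((Real.sqrt m.toReal)⁻¹ : ℂ), by
      rw [coe_nnnorm_sq_eq_ofReal, norm_inv, Complex.norm_real,
        Real.norm_of_nonneg (Real.sqrt_nonneg _), inv_pow, Real.sq_sqrt hmpos.le,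
        ENNReal.ofReal_inv_of_pos hmpos, ENNReal.ofReal_toReal hmtop]⟩
  have hctop : ((‖c‖₊ : ℝ≥0∞)) ^ 2 ≠ ⊤ := ENNReal.pow_ne_top ENNReal.coe_ne_top
  have hsq : ∀ X, ((‖c * f X‖₊ : ℝ≥0∞)) ^ 2 = ((‖c‖₊ : ℝ≥0∞)) ^ 2 * ((‖f X‖₊ : ℝ≥0∞)) ^ 2 :=
    fun X => by rw [nnnorm_mul, ENNReal.coe_mul, mul_pow]
  -- the rescaled function `c • f` is an admissible (normalised, periodic, `C¹`) function
  have hg : ContDiff ℝ 1 fun X => c * f X := contDiff_const.mul hf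
  have hgper : ∀ (X : Config M) (i : Fin M) (k : Fin 3),
      c * f (X + Pi.single i (EuclideanSpace.single k L)) = c * f X := fun X i k => by rw [hper]
  have hg1 : ∫⁻ X in cellN M L, ((‖c * f X‖₊ : ℝ≥0∞)) ^ 2 = 1 := by
    simp_rw [hsq]
    rw [lintegral_const_mul' _ _ hctop, hc2, ENNReal.inv_mul_cancel hm0 hmtop]
  have hE := periodicGroundStateEnergy_le_lintegral_of_periodic hv hg hgper hg1
  have hE' : ∫⁻ X in cellN M L, (kineticDensity (fun X => c * f X) X +
      periodicInteraction v L X * ((‖c * f X‖₊ : ℝ≥0∞)) ^ 2) =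
        m⁻¹ * ∫⁻ X in cellN M L,
          (kineticDensity f X + periodicInteraction v L X * ((‖f X‖₊ : ℝ≥0∞)) ^ 2) := by
    rw [← hc2, ← lintegral_const_mul' _ _ hctop]
    refine lintegral_congr fun X => ?_
    rw [kineticDensity_const_mul_complex, hsq]
    ring
  rw [hE'] at hE
  calc periodicGroundStateEnergy v M L * m
      ≤ (m⁻¹ * ∫⁻ X in cellN M L,
          (kineticDensity f X + periodicInteraction v L X * ((‖f X‖₊ : ℝ≥0∞)) ^ 2)) * m :=
        mul_le_mul' hE le_rfl
    _ = _ := by rw [mul_comm m⁻¹, mul_assoc, ENNReal.inv_mul_cancel hm0 hmtop, mul_one]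

/-- The two-copy cell `[0,L)^{3M} × [0,L)^{3M}` carries the product of the restricted Lebesgue
measures. [folklore] -/
theorem volume_restrict_cellN_prod (M : ℕ) (L : ℝ) :
    (volume : Measure (Config M × Config M)).restrict (cellN M L ×ˢ cellN M L) =
      ((volume : Measure (Config M)).restrict (cellN M L)).prod
        ((volume : Measure (Config M)).restrict (cellN M L)) := by
  rw [Measure.prod_restrict, ← Measure.volume_eq_prod]

/-- **Left slice floor.** For a `C¹` two-copy function `Θ(X, Y)` periodic in the first copy,
`E₀^per(M, L) · ∫_{cell²} |Θ|² ≤ ∫_{cell²} |∇_X Θ|² + V(X) |Θ|²`: Tonelli with the `X`-integral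
inside and the homogeneous bosonic floor slice by slice. [folklore] -/
theorem periodicGroundStateEnergy_mul_le_lintegral_sliceLeft {v : ℝ → ℝ≥0∞} (hv : Measurable v)
    {Θ : Config M × Config M → ℂ} (hΘ : ContDiff ℝ 1 Θ)
    (hper : ∀ (Z : Config M × Config M) (i : Fin M) (k : Fin 3),
      Θ (Z.1 + Pi.single i (EuclideanSpace.single k L), Z.2) = Θ Z) :
    periodicGroundStateEnergy v M L *
        ∫⁻ Z in cellN M L ×ˢ cellN M L, ((‖Θ Z‖₊ : ℝ≥0∞)) ^ 2 ≤
      ∫⁻ Z in cellN M L ×ˢ cellN M L,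
        (kineticDensity (fun X => Θ (X, Z.2)) Z.1 +
          periodicInteraction v L Z.1 * ((‖Θ Z‖₊ : ℝ≥0∞)) ^ 2) := by
  have hΘm : Measurable fun Z => ((‖Θ Z‖₊ : ℝ≥0∞)) ^ 2 :=
    hΘ.continuous.measurable.nnnorm.coe_nnreal_ennreal.pow_const _
  have hkin : Measurable fun Z : Config M × Config M =>
      kineticDensity (fun X => Θ (X, Z.2)) Z.1 := by
    have hc : Continuous (Function.uncurry fun (Y : Config M) (X : Config M) => Θ (X, Y)) :=
      hΘ.continuous.comp continuous_swap
    unfold kineticDensity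
    refine Finset.measurable_sum _ fun i _ => Finset.measurable_sum _ fun k _ => ?_
    exact ((measurable_fderiv_apply_const_with_param ℝ hc _).comp
      measurable_swap).nnnorm.coe_nnreal_ennreal.pow_const _
  have hA : Measurable fun Z : Config M × Config M =>
      kineticDensity (fun X => Θ (X, Z.2)) Z.1 +
        periodicInteraction v L Z.1 * ((‖Θ Z‖₊ : ℝ≥0∞)) ^ 2 :=
    hkin.add (((measurable_periodicInteraction hv L).comp measurable_fst).mul hΘm)
  rw [volume_restrict_cellN_prod, lintegral_prod_symm _ hΘm.aemeasurable,
    lintegral_prod_symm _ hA.aemeasurable,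
    ← lintegral_const_mul _ (hΘm.lintegral_prod_left'
      (μ := (volume : Measure (Config M)).restrict (cellN M L)))]
  refine lintegral_mono fun Y => ?_
  exact periodicGroundStateEnergy_mul_normSq_le_of_periodic hv (f := fun X => Θ (X, Y))
    (hΘ.comp (contDiff_prodMk_left Y)) (fun X i k => hper (X, Y) i k)

/-- **Right slice floor.** For a `C¹` two-copy function `Θ(X, Y)` periodic in the second copy,
`E₀^per(M, L) · ∫_{cell²} |Θ|² ≤ ∫_{cell²} |∇_Y Θ|² + V(Y) |Θ|²`. [folklore] -/
theorem periodicGroundStateEnergy_mul_le_lintegral_sliceRight {v : ℝ → ℝ≥0∞} (hv : Measurable v)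
    {Θ : Config M × Config M → ℂ} (hΘ : ContDiff ℝ 1 Θ)
    (hper : ∀ (Z : Config M × Config M) (i : Fin M) (k : Fin 3),
      Θ (Z.1, Z.2 + Pi.single i (EuclideanSpace.single k L)) = Θ Z) :
    periodicGroundStateEnergy v M L *
        ∫⁻ Z in cellN M L ×ˢ cellN M L, ((‖Θ Z‖₊ : ℝ≥0∞)) ^ 2 ≤
      ∫⁻ Z in cellN M L ×ˢ cellN M L,
        (kineticDensity (fun Y => Θ (Z.1, Y)) Z.2 +
          periodicInteraction v L Z.2 * ((‖Θ Z‖₊ : ℝ≥0∞)) ^ 2) := by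
  have hΘm : Measurable fun Z => ((‖Θ Z‖₊ : ℝ≥0∞)) ^ 2 :=
    hΘ.continuous.measurable.nnnorm.coe_nnreal_ennreal.pow_const _
  have hkin : Measurable fun Z : Config M × Config M =>
      kineticDensity (fun Y => Θ (Z.1, Y)) Z.2 := by
    have hc : Continuous (Function.uncurry fun (X : Config M) (Y : Config M) => Θ (X, Y)) :=
      hΘ.continuous
    unfold kineticDensity
    refine Finset.measurable_sum _ fun i _ => Finset.measurable_sum _ fun k _ => ?_
    exact (measurable_fderiv_apply_const_with_param ℝ hc _).nnnorm.coe_nnreal_ennreal.pow_const _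
  have hB : Measurable fun Z : Config M × Config M =>
      kineticDensity (fun Y => Θ (Z.1, Y)) Z.2 +
        periodicInteraction v L Z.2 * ((‖Θ Z‖₊ : ℝ≥0∞)) ^ 2 :=
    hkin.add (((measurable_periodicInteraction hv L).comp measurable_snd).mul hΘm)
  rw [volume_restrict_cellN_prod, lintegral_prod _ hΘm.aemeasurable,
    lintegral_prod _ hB.aemeasurable,
    ← lintegral_const_mul _ (hΘm.lintegral_prod_right'
      (ν := (volume : Measure (Config M)).restrict (cellN M L)))]
  refine lintegral_mono fun X => ?_
  exact periodicGroundStateEnergy_mul_normSq_le_of_periodic hv (f := fun Y => Θ (X, Y))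
    (hΘ.comp (contDiff_prodMk_right X)) (fun Y i k => hper (X, Y) i k)

end ProductLower

/-! ### The registered stub -/

/-- **`2 E₀^per(n+1, L) ≤ E2(0)(Θ)` for `Θ ∈ Adm0`** (`stub_productLower`, registered signature). [folklore] -/
theorem stub_productLower :
    ∀ v : ℝ → ℝ≥0∞, IsRepulsiveFiniteRange v → ∀ (n : ℕ) (L : ℝ) (Θ : Config (n + 1) × Config (n + 1) → ℂ),
      let C2 : Set (Config (n + 1) × Config (n + 1)) := (cellN (n + 1) L) ×ˢ (cellN (n + 1) L)
      let E2z : (Config (n + 1) × Config (n + 1) → ℂ) → ℝ≥0∞ := fun Θ => ∫⁻ Z in C2,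
          kineticDensity (fun X => Θ (X, Z.2)) Z.1 + kineticDensity (fun Y => Θ (Z.1, Y)) Z.2 +
            (periodicInteraction v L Z.1 + periodicInteraction v L Z.2) * (‖Θ Z‖₊ : ENNReal) ^ 2
      let Adm : (Config (n + 1) × Config (n + 1) → ℂ) → Prop := fun Θ => ContDiff ℝ 1 Θ ∧
          (∀ (Z : Config (n + 1) × Config (n + 1)) (i : Fin (n + 1)) (k : Fin 3),
            Θ (Z.1 + Pi.single i (EuclideanSpace.single k L), Z.2) = Θ Z ∧
              Θ (Z.1, Z.2 + Pi.single i (EuclideanSpace.single k L)) = Θ Z) ∧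
          ∫⁻ Z in C2, (‖Θ Z‖₊ : ENNReal) ^ 2 = 1
      Adm Θ → 2 * periodicGroundStateEnergy v (n + 1) L ≤ E2z Θ := by
  intro v hv n L Θ
  dsimp only
  rintro ⟨hC1, hper, hnorm⟩
  have h1 := ProductLower.periodicGroundStateEnergy_mul_le_lintegral_sliceLeft hv.1 hC1
    fun Z i k => (hper Z i k).1
  have h2 := ProductLower.periodicGroundStateEnergy_mul_le_lintegral_sliceRight hv.1 hC1
    fun Z i k => (hper Z i k).2
  rw [hnorm, mul_one] at h1 h2
  refine (le_of_eq (two_mul _)).trans ((add_le_add h1 h2).trans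
    ((le_lintegral_add _ _).trans (le_of_eq (lintegral_congr fun Z => ?_))))
  ring

end Summit.AtomisticToContinuum.BoseEinsteinCondensation.Cruxes.TorusHalfSwapOverlap.Birth

end
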